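import Mathlib

/-!
# `SnSubsetDichotomy.PolynomialSlack`, line `quotient-globalisation-by-pruning` — stub `relativeMixing_transport`

TRANSPORT OF PRODUCT MIXING TO A POINT STABILISER (crux `stmt-MatrixMultiplication-8306`,
registered stub `relativeMixing_transport` = the lead's skeleton stub `stub_relativeMixing` for
line `quotient-globalisation-by-pruning`, with its three abbreviations unfolded).

The Keevash–Lifshitz product-mixing theorem for `100`-global dense even subsets of `S_m`
(arXiv:2307.15030, Thm. 1.14 with Def. 1.6) is the HYPOTHESIS of the implication proved here; it
is neither proved nor cited as a dependency.  The conclusion is the same statement inside the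
pointwise stabiliser `Stab_pw(L) = {σ ∈ S_n | ∀ k, σ (L k) = L k}` of an injective tuple
`L : Fin t → Fin n`, which is isomorphic to `S_{n-t}`.  Everything here is transport along that
isomorphism:

* `exists_stabiliser_transport` — for injective `L` there are a monoid hom
  `ψ : Perm (Fin (n - t)) →* Perm (Fin n)` and an injection `ι : Fin (n - t) → Fin n` with `ψ`
  injective, sign-preserving, `ι`-equivariant (`ψ π (ι x) = ι (π x)`), and with image exactly
  `Stab_pw(L)` (built from `Equiv.Perm.ofSubtype`, `Equiv.permCongrHom` and
  `Equiv.Perm.subtypeEquivSubtypePerm` on the complement of `range L`);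
* `card_pullback`, `card_pullback_filter`, `card_pullback_prod` — cardinalities of pull-backs
  `{π | ψ π ∈ X}` of sets `X ⊆ image ψ` along an injective (multiplicative) map;
* `globalWithin_pullback` — relative `r`-globalness of `X` within the image of `ψ` gives
  `r`-globalness of the pull-back of `X` in `S_{n-t}` (a `t'`-umvirate `U_{I→J}` of `S_{n-t}` is
  the trace of the umvirate `U_{ι∘I→ι∘J}` of `S_n`);
* `relativeMixing_transport` — the registered stub `stub_relativeMixing` with the skeleton's
  `IsGlobalWithin`, `IsGlobal`, `stabFinset` UNFOLDED (definitionally equal; the skeleton's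
  names live in a `Cruxes/` work file that a `Theorems/` file cannot import, hence the unfolded
  text is registered under this name): apply the hypothesis in `S_{n-t}` to the three
  pull-backs and transport the solution count of `ab = c` back along `ψ × ψ`.

No Literature fact is used; Mathlib only.
-/

open Finset

-- `Summit.<Summit>.<Problem>` is the tree's mandated summit-side namespace (CONVENTIONS §2); for
-- this single-problem summit `<Summit> = <Problem>`, so the duplicate component is deliberate.
set_option linter.dupNamespace false

namespace Summit.MatrixMultiplication.MatrixMultiplication.Theorems.PolynomialSlack

/-- **The stabiliser transport.** For an injective tuple `L : Fin t → Fin n` there are a monoid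
homomorphism `ψ : Perm (Fin (n - t)) →* Perm (Fin n)` and an injection `ι : Fin (n - t) → Fin n`
(an enumeration of the complement of `range L`) such that `ψ` is injective, preserves the sign,
is `ι`-equivariant, fixes every `L k`, and hits every permutation fixing `range L` pointwise:
the image of `ψ` is exactly the pointwise stabiliser `Stab_pw(L) ≅ S_{n-t}`. [folklore] -/
theorem exists_stabiliser_transport {n t : ℕ} (L : Fin t → Fin n)
    (hL : Function.Injective L) :
    ∃ (ψ : Equiv.Perm (Fin (n - t)) →* Equiv.Perm (Fin n)) (ι : Fin (n - t) → Fin n),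
      Function.Injective ψ ∧ Function.Injective ι ∧
      (∀ π, Equiv.Perm.sign (ψ π) = Equiv.Perm.sign π) ∧
      (∀ π x, ψ π (ι x) = ι (π x)) ∧
      (∀ π k, ψ π (L k) = L k) ∧
      (∀ σ : Equiv.Perm (Fin n), (∀ k, σ (L k) = L k) → ∃ π, ψ π = σ) := by
  classical
  -- the complement of `range L` and an enumeration of it by `Fin (n - t)`
  set p : Fin n → Prop := fun x => x ∉ Set.range L with hp
  have hcard : Fintype.card {x // p x} = n - t := by
    simp only [hp]
    rw [Fintype.card_subtype_compl, Fintype.card_fin, Set.card_range_of_injective hL,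
      Fintype.card_fin]
  set e : {x // p x} ≃ Fin (n - t) := Fintype.equivFinOfCardEq hcard with he
  refine ⟨Equiv.Perm.ofSubtype.comp e.symm.permCongrHom.toMonoidHom,
    fun x => ((e.symm x : {x // p x}) : Fin n), ?_, ?_, ?_, ?_, ?_, ?_⟩
  · exact Equiv.Perm.ofSubtype_injective.comp e.symm.permCongrHom.injective
  · exact Subtype.val_injective.comp e.symm.injective
  · intro π
    simp
  · intro π x
    simp
  · intro π k
    have hk : ¬ p (L k) := by simp [hp]
    exact Equiv.Perm.ofSubtype_apply_of_not_mem _ hk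
  · intro σ hσ
    have hσ' : ∀ a, ¬ p a → σ a = a := by
      intro a ha
      simp only [hp, Set.mem_range, not_exists, not_forall, not_not] at ha
      obtain ⟨k, rfl⟩ := ha
      exact hσ k
    obtain ⟨τ, h1⟩ : ∃ τ : Equiv.Perm {x // p x}, Equiv.Perm.ofSubtype τ = σ :=
      ⟨(Equiv.Perm.subtypeEquivSubtypePerm p).symm ⟨σ, hσ'⟩, by
        have := congrArg Subtype.val
          ((Equiv.Perm.subtypeEquivSubtypePerm p).apply_symm_apply ⟨σ, hσ'⟩)
        simpa using this⟩
    refine ⟨e.permCongr τ, ?_⟩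
    have h2 : e.symm.permCongr (e.permCongr τ) = τ := by
      rw [← Equiv.permCongr_symm]
      exact e.permCongr.symm_apply_apply τ
    simp only [MonoidHom.coe_comp, Function.comp_apply, MulEquiv.coe_toMonoidHom,
      Equiv.permCongrHom_coe]
    rw [h2, h1]

/-- **Pull-back count.** For an injective map `ψ` and a finite set `X` contained in its image,
the pull-back `{π | ψ π ∈ X}` has the same cardinality as `X`. [folklore] -/
theorem card_pullback {G H : Type*} [Fintype G] [DecidableEq H] {ψ : G → H}
    (hψ : Function.Injective ψ) {X : Finset H} (hX : ∀ σ ∈ X, ∃ π, ψ π = σ) :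
    (Finset.univ.filter (fun π => ψ π ∈ X)).card = X.card := by
  refine Finset.card_nbij ψ (fun π hπ => by simpa using hπ) hψ.injOn ?_
  intro σ hσ
  obtain ⟨π, rfl⟩ := hX σ (by simpa using hσ)
  exact ⟨π, by simpa using hσ, rfl⟩

/-- **Pull-back count with a side condition.** For an injective map `ψ`, a finite set `X`
contained in its image and a predicate `P`, the elements `π` of the pull-back of `X` with
`P (ψ π)` are equinumerous with the elements of `X` satisfying `P`. [folklore] -/
theorem card_pullback_filter {G H : Type*} [Fintype G] [DecidableEq H] {ψ : G → H}
    (hψ : Function.Injective ψ) {X : Finset H} (hX : ∀ σ ∈ X, ∃ π, ψ π = σ)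
    (P : H → Prop) [DecidablePred P] :
    ((Finset.univ.filter (fun π => ψ π ∈ X)).filter (fun π => P (ψ π))).card =
      (X.filter P).card := by
  rw [← card_pullback hψ (X := X.filter P) (fun σ hσ => hX σ (Finset.mem_of_mem_filter σ hσ)),
    Finset.filter_filter]
  congr 1
  ext π
  simp

/-- **Pull-back of the solution count of `ab = c`.** For an injective multiplicative map `ψ`
and finite sets `A, B` contained in its image, the pairs `(π, ρ)` of the pull-backs of `A, B`
with `π * ρ` in the pull-back of `C` are in bijection (via `ψ × ψ`) with the pairs
`(a, b) ∈ A × B` with `a * b ∈ C`. [folklore] -/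
theorem card_pullback_prod {G H : Type*} [Fintype G] [DecidableEq G] [Mul G] [Mul H]
    [DecidableEq H] {ψ : G → H} (hψ : Function.Injective ψ) (hmul : ∀ a b, ψ (a * b) = ψ a * ψ b)
    {A B : Finset H} (hA : ∀ σ ∈ A, ∃ π, ψ π = σ) (hB : ∀ σ ∈ B, ∃ π, ψ π = σ)
    (C : Finset H) :
    (((Finset.univ.filter (fun π => ψ π ∈ A)) ×ˢ (Finset.univ.filter (fun π => ψ π ∈ B))).filter
        (fun ab => ab.1 * ab.2 ∈ Finset.univ.filter (fun π => ψ π ∈ C))).card =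
      ((A ×ˢ B).filter (fun ab => ab.1 * ab.2 ∈ C)).card := by
  refine Finset.card_nbij (fun ab => (ψ ab.1, ψ ab.2)) ?_ ?_ ?_
  · rintro ⟨a, b⟩ hab
    simp only [coe_filter, mem_product, mem_filter, mem_univ, true_and,
      Set.mem_setOf_eq] at hab ⊢
    exact ⟨hab.1, by rw [← hmul]; exact hab.2⟩
  · rintro ⟨a, b⟩ - ⟨a', b'⟩ - h
    simp only [Prod.mk.injEq] at h
    exact Prod.ext (hψ h.1) (hψ h.2)
  · rintro ⟨σ, τ⟩ hστ
    simp only [coe_filter, mem_product, Set.mem_setOf_eq] at hστ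
    obtain ⟨a, rfl⟩ := hA σ hστ.1.1
    obtain ⟨b, rfl⟩ := hB τ hστ.1.2
    refine ⟨(a, b), ?_, rfl⟩
    simp only [coe_filter, mem_product, mem_filter, mem_univ, true_and, Set.mem_setOf_eq]
    exact ⟨hστ.1, by rw [hmul]; exact hστ.2⟩

/-- **Relative globalness pulls back to globalness.** Let `ψ : Perm (Fin m) → Perm (Fin n)` be
injective and `ι`-equivariant for an injection `ι : Fin m → Fin n`, with image the finite set
`H`.  If `X ⊆ H` is `r`-global WITHIN `H` (restricting to any `t`-umvirate `U_{I→J}` of `S_n`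
multiplies the density relative to `H` by at most `r^{2t}`), then the pull-back of `X` is
`r`-global in `S_m`: the `t`-umvirate `U_{I→J}` of `S_m` is the trace of `U_{ι∘I→ι∘J}`.
[folklore] -/
theorem globalWithin_pullback {n m : ℕ} {ψ : Equiv.Perm (Fin m) → Equiv.Perm (Fin n)}
    {ι : Fin m → Fin n} (hψ : Function.Injective ψ) (hι : Function.Injective ι)
    (hequiv : ∀ π x, ψ π (ι x) = ι (π x)) {H : Finset (Equiv.Perm (Fin n))}
    (hH : ∀ σ, σ ∈ H ↔ ∃ π, ψ π = σ) {r : ℝ} {X : Finset (Equiv.Perm (Fin n))}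
    (hX : X ⊆ H ∧ ∀ t : ℕ, ∀ I J : Fin t → Fin n, Function.Injective I → Function.Injective J →
      ((X.filter (fun σ => ∀ k, σ (I k) = J k)).card : ℝ) * (H.card : ℝ) ≤
        r ^ (2 * t) * (X.card : ℝ) * ((H.filter (fun σ => ∀ k, σ (I k) = J k)).card : ℝ)) :
    Finset.univ.filter (fun π => ψ π ∈ X) ⊆ Finset.univ ∧
      ∀ t : ℕ, ∀ I J : Fin t → Fin m, Function.Injective I → Function.Injective J →
      (((Finset.univ.filter (fun π => ψ π ∈ X)).filter (fun σ => ∀ k, σ (I k) = J k)).card : ℝ) *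
          ((Finset.univ : Finset (Equiv.Perm (Fin m))).card : ℝ) ≤
        r ^ (2 * t) * ((Finset.univ.filter (fun π => ψ π ∈ X)).card : ℝ) *
          (((Finset.univ : Finset (Equiv.Perm (Fin m))).filter
            (fun σ => ∀ k, σ (I k) = J k)).card : ℝ) := by
  refine ⟨Finset.subset_univ _, fun t I J hI hJ => ?_⟩
  have hXs : ∀ σ ∈ X, ∃ π, ψ π = σ := fun σ hσ => (hH σ).1 (hX.1 hσ)
  have hHs : ∀ σ ∈ H, ∃ π, ψ π = σ := fun σ hσ => (hH σ).1 hσ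
  have hHuniv : Finset.univ.filter (fun π => ψ π ∈ H) = Finset.univ :=
    Finset.filter_true_of_mem fun π _ => (hH _).2 ⟨π, rfl⟩
  have key := hX.2 t (ι ∘ I) (ι ∘ J) (hι.comp hI) (hι.comp hJ)
  -- the umvirate `U_{ι∘I→ι∘J}` of `S_n` pulls back to the umvirate `U_{I→J}` of `S_m`
  have hP : ∀ π : Equiv.Perm (Fin m),
      (∀ k, ψ π ((ι ∘ I) k) = (ι ∘ J) k) ↔ ∀ k, π (I k) = J k := by
    intro π
    simp only [Function.comp_apply, hequiv, hι.eq_iff]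
  have h1 : (X.filter (fun σ => ∀ k, σ ((ι ∘ I) k) = (ι ∘ J) k)).card =
      ((Finset.univ.filter (fun π => ψ π ∈ X)).filter (fun σ => ∀ k, σ (I k) = J k)).card := by
    rw [← card_pullback_filter hψ hXs (fun σ => ∀ k, σ ((ι ∘ I) k) = (ι ∘ J) k)]
    exact congrArg Finset.card (Finset.filter_congr fun π _ => hP π)
  have h2 : H.card = (Finset.univ : Finset (Equiv.Perm (Fin m))).card := by
    rw [← card_pullback hψ hHs, hHuniv]
  have h3 : X.card = (Finset.univ.filter (fun π => ψ π ∈ X)).card := (card_pullback hψ hXs).symm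
  have h4 : (H.filter (fun σ => ∀ k, σ ((ι ∘ I) k) = (ι ∘ J) k)).card =
      ((Finset.univ : Finset (Equiv.Perm (Fin m))).filter (fun σ => ∀ k, σ (I k) = J k)).card := by
    rw [← card_pullback_filter hψ hHs (fun σ => ∀ k, σ ((ι ∘ I) k) = (ι ∘ J) k), hHuniv]
    exact congrArg Finset.card (Finset.filter_congr fun π _ => hP π)
  rw [h1, h2, h3, h4] at key
  exact key

/-- **Registered stub `relativeMixing_transport`** (= the skeleton's `stub_relativeMixing`, line
`quotient-globalisation-by-pruning` of crux `stmt-MatrixMultiplication-8306`, with the skeleton's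
`IsGlobalWithin`, `IsGlobal` and `stabFinset` unfolded — definitionally equal).  IF the
Keevash–Lifshitz product-mixing statement holds in every `S_n` (for some absolute `c > 0` and
all large `n`: even `100`-global `A, B, C ⊆ S_n` of densities
`≥ e^{-c n^{1/3}}` in `A_n` have `#{(a,b) ∈ A × B | ab ∈ C} ≥ 0.99 |A||B||C| / (n!/2)`), THEN
the same holds inside the pointwise stabiliser `Stab_pw(L) ≅ S_{n-t}` of any injective
`L : Fin t → Fin n` with `n - t` large, for even `A, B, C ⊆ Stab_pw(L)` that are `100`-global
within `Stab_pw(L)` and `e^{-c (n-t)^{1/3}}`-dense in `|Stab_pw(L)|/2`.  Pure transport along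
`exists_stabiliser_transport`. [folklore] -/
theorem relativeMixing_transport :
    (∃ c : ℝ, 0 < c ∧ ∃ n₀ : ℕ, ∀ n ≥ n₀, ∀ A B C : Finset (Equiv.Perm (Fin n)),
    (∀ σ ∈ A, Equiv.Perm.sign σ = 1) → (∀ σ ∈ B, Equiv.Perm.sign σ = 1) →
    (∀ σ ∈ C, Equiv.Perm.sign σ = 1) →
    ((A ⊆ Finset.univ ∧ ∀ t : ℕ, ∀ I J : Fin t → Fin n, Function.Injective I → Function.Injective J →
      ((A.filter (fun σ => ∀ k, σ (I k) = J k)).card : ℝ) * ((Finset.univ : Finset (Equiv.Perm (Fin n))).card : ℝ) ≤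
        (100 : ℝ) ^ (2 * t) * (A.card : ℝ) * (((Finset.univ : Finset (Equiv.Perm (Fin n))).filter (fun σ => ∀ k, σ (I k) = J k)).card : ℝ))) →
    ((B ⊆ Finset.univ ∧ ∀ t : ℕ, ∀ I J : Fin t → Fin n, Function.Injective I → Function.Injective J →
      ((B.filter (fun σ => ∀ k, σ (I k) = J k)).card : ℝ) * ((Finset.univ : Finset (Equiv.Perm (Fin n))).card : ℝ) ≤
        (100 : ℝ) ^ (2 * t) * (B.card : ℝ) * (((Finset.univ : Finset (Equiv.Perm (Fin n))).filter (fun σ => ∀ k, σ (I k) = J k)).card : ℝ))) →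
    ((C ⊆ Finset.univ ∧ ∀ t : ℕ, ∀ I J : Fin t → Fin n, Function.Injective I → Function.Injective J →
      ((C.filter (fun σ => ∀ k, σ (I k) = J k)).card : ℝ) * ((Finset.univ : Finset (Equiv.Perm (Fin n))).card : ℝ) ≤
        (100 : ℝ) ^ (2 * t) * (C.card : ℝ) * (((Finset.univ : Finset (Equiv.Perm (Fin n))).filter (fun σ => ∀ k, σ (I k) = J k)).card : ℝ))) →
    Real.exp (-(c * (n : ℝ) ^ ((1 : ℝ) / 3))) * ((n.factorial : ℝ) / 2) ≤ (A.card : ℝ) →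
    Real.exp (-(c * (n : ℝ) ^ ((1 : ℝ) / 3))) * ((n.factorial : ℝ) / 2) ≤ (B.card : ℝ) →
    Real.exp (-(c * (n : ℝ) ^ ((1 : ℝ) / 3))) * ((n.factorial : ℝ) / 2) ≤ (C.card : ℝ) →
    0.99 * ((A.card : ℝ) * (B.card : ℝ) * (C.card : ℝ)) / ((n.factorial : ℝ) / 2) ≤
    (((A ×ˢ B).filter (fun ab => ab.1 * ab.2 ∈ C)).card : ℝ)) →
    ∃ c : ℝ, 0 < c ∧ ∃ m₀ : ℕ, ∀ (n t : ℕ) (L : Fin t → Fin n), Function.Injective L → m₀ + t ≤ n →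
    ∀ A B C : Finset (Equiv.Perm (Fin n)),
    (∀ σ ∈ A, Equiv.Perm.sign σ = 1) → (∀ σ ∈ B, Equiv.Perm.sign σ = 1) →
    (∀ σ ∈ C, Equiv.Perm.sign σ = 1) →
    ((A ⊆ Finset.univ.filter (fun σ : Equiv.Perm (Fin n) => ∀ k, σ (L k) = L k) ∧
      ∀ t' : ℕ, ∀ I J : Fin t' → Fin n, Function.Injective I → Function.Injective J →
      ((A.filter (fun σ => ∀ k, σ (I k) = J k)).card : ℝ) *
          ((Finset.univ.filter (fun σ : Equiv.Perm (Fin n) => ∀ k, σ (L k) = L k)).card : ℝ) ≤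
        (100 : ℝ) ^ (2 * t') * (A.card : ℝ) *
          (((Finset.univ.filter (fun σ : Equiv.Perm (Fin n) => ∀ k, σ (L k) = L k)).filter
            (fun σ => ∀ k, σ (I k) = J k)).card : ℝ))) →
    ((B ⊆ Finset.univ.filter (fun σ : Equiv.Perm (Fin n) => ∀ k, σ (L k) = L k) ∧
      ∀ t' : ℕ, ∀ I J : Fin t' → Fin n, Function.Injective I → Function.Injective J →
      ((B.filter (fun σ => ∀ k, σ (I k) = J k)).card : ℝ) *
          ((Finset.univ.filter (fun σ : Equiv.Perm (Fin n) => ∀ k, σ (L k) = L k)).card : ℝ) ≤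
        (100 : ℝ) ^ (2 * t') * (B.card : ℝ) *
          (((Finset.univ.filter (fun σ : Equiv.Perm (Fin n) => ∀ k, σ (L k) = L k)).filter
            (fun σ => ∀ k, σ (I k) = J k)).card : ℝ))) →
    ((C ⊆ Finset.univ.filter (fun σ : Equiv.Perm (Fin n) => ∀ k, σ (L k) = L k) ∧
      ∀ t' : ℕ, ∀ I J : Fin t' → Fin n, Function.Injective I → Function.Injective J →
      ((C.filter (fun σ => ∀ k, σ (I k) = J k)).card : ℝ) *
          ((Finset.univ.filter (fun σ : Equiv.Perm (Fin n) => ∀ k, σ (L k) = L k)).card : ℝ) ≤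
        (100 : ℝ) ^ (2 * t') * (C.card : ℝ) *
          (((Finset.univ.filter (fun σ : Equiv.Perm (Fin n) => ∀ k, σ (L k) = L k)).filter
            (fun σ => ∀ k, σ (I k) = J k)).card : ℝ))) →
    Real.exp (-(c * ((n - t : ℕ) : ℝ) ^ ((1 : ℝ) / 3))) *
        (((Finset.univ.filter (fun σ : Equiv.Perm (Fin n) => ∀ k, σ (L k) = L k)).card : ℝ) / 2) ≤ (A.card : ℝ) →
    Real.exp (-(c * ((n - t : ℕ) : ℝ) ^ ((1 : ℝ) / 3))) *
        (((Finset.univ.filter (fun σ : Equiv.Perm (Fin n) => ∀ k, σ (L k) = L k)).card : ℝ) / 2) ≤ (B.card : ℝ) →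
    Real.exp (-(c * ((n - t : ℕ) : ℝ) ^ ((1 : ℝ) / 3))) *
        (((Finset.univ.filter (fun σ : Equiv.Perm (Fin n) => ∀ k, σ (L k) = L k)).card : ℝ) / 2) ≤ (C.card : ℝ) →
    0.99 * ((A.card : ℝ) * (B.card : ℝ) * (C.card : ℝ)) /
        (((Finset.univ.filter (fun σ : Equiv.Perm (Fin n) => ∀ k, σ (L k) = L k)).card : ℝ) / 2) ≤
      (((A ×ˢ B).filter (fun ab => ab.1 * ab.2 ∈ C)).card : ℝ) := by
  classical
  rintro ⟨c, hc, n₀, hKL⟩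
  refine ⟨c, hc, n₀, ?_⟩
  intro n t L hL hle A B C hAe hBe hCe hAg hBg hCg hAd hBd hCd
  obtain ⟨ψ, ι, hψ, hι, hsign, hequiv, hfix, hsurj⟩ := exists_stabiliser_transport L hL
  -- the host `Stab_pw(L)` is exactly the image of `ψ`
  have hH : ∀ σ, σ ∈ Finset.univ.filter (fun σ : Equiv.Perm (Fin n) => ∀ k, σ (L k) = L k) ↔
      ∃ π, ψ π = σ := by
    intro σ
    simp only [Finset.mem_filter, Finset.mem_univ, true_and]
    exact ⟨hsurj σ, by rintro ⟨π, rfl⟩; exact hfix π⟩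
  have hHs : ∀ σ ∈ Finset.univ.filter (fun σ : Equiv.Perm (Fin n) => ∀ k, σ (L k) = L k),
      ∃ π, ψ π = σ := fun σ hσ => (hH σ).1 hσ
  have hAs : ∀ σ ∈ A, ∃ π, ψ π = σ := fun σ hσ => (hH σ).1 (hAg.1 hσ)
  have hBs : ∀ σ ∈ B, ∃ π, ψ π = σ := fun σ hσ => (hH σ).1 (hBg.1 hσ)
  have hCs : ∀ σ ∈ C, ∃ π, ψ π = σ := fun σ hσ => (hH σ).1 (hCg.1 hσ)
  -- cardinalities: `|Stab_pw(L)| = (n - t)!` and the pull-backs have the same size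
  have hHcard : (Finset.univ.filter (fun σ : Equiv.Perm (Fin n) => ∀ k, σ (L k) = L k)).card =
      (n - t).factorial := by
    rw [← card_pullback hψ hHs, Finset.filter_true_of_mem (fun π _ => (hH _).2 ⟨π, rfl⟩),
      Finset.card_univ, Fintype.card_perm, Fintype.card_fin]
  have hAcard : (Finset.univ.filter (fun π => ψ π ∈ A)).card = A.card := card_pullback hψ hAs
  have hBcard : (Finset.univ.filter (fun π => ψ π ∈ B)).card = B.card := card_pullback hψ hBs
  have hCcard : (Finset.univ.filter (fun π => ψ π ∈ C)).card = C.card := card_pullback hψ hCs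
  -- evenness is preserved (`ψ` preserves the sign)
  have hAe' : ∀ π ∈ Finset.univ.filter (fun π => ψ π ∈ A), Equiv.Perm.sign π = 1 := by
    intro π hπ
    rw [← hsign]
    exact hAe _ (by simpa using hπ)
  have hBe' : ∀ π ∈ Finset.univ.filter (fun π => ψ π ∈ B), Equiv.Perm.sign π = 1 := by
    intro π hπ
    rw [← hsign]
    exact hBe _ (by simpa using hπ)
  have hCe' : ∀ π ∈ Finset.univ.filter (fun π => ψ π ∈ C), Equiv.Perm.sign π = 1 := by
    intro π hπ
    rw [← hsign]
    exact hCe _ (by simpa using hπ)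
  -- relative globalness pulls back to globalness in `S_{n-t}`
  have hAg' := globalWithin_pullback hψ hι hequiv hH hAg
  have hBg' := globalWithin_pullback hψ hι hequiv hH hBg
  have hCg' := globalWithin_pullback hψ hι hequiv hH hCg
  -- densities
  have hAd' : Real.exp (-(c * ((n - t : ℕ) : ℝ) ^ ((1 : ℝ) / 3))) *
      (((n - t).factorial : ℝ) / 2) ≤ ((Finset.univ.filter (fun π => ψ π ∈ A)).card : ℝ) := by
    rw [hAcard, ← hHcard]; exact hAd
  have hBd' : Real.exp (-(c * ((n - t : ℕ) : ℝ) ^ ((1 : ℝ) / 3))) *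
      (((n - t).factorial : ℝ) / 2) ≤ ((Finset.univ.filter (fun π => ψ π ∈ B)).card : ℝ) := by
    rw [hBcard, ← hHcard]; exact hBd
  have hCd' : Real.exp (-(c * ((n - t : ℕ) : ℝ) ^ ((1 : ℝ) / 3))) *
      (((n - t).factorial : ℝ) / 2) ≤ ((Finset.univ.filter (fun π => ψ π ∈ C)).card : ℝ) := by
    rw [hCcard, ← hHcard]; exact hCd
  -- the solution count of `ab = c` is transported along `ψ × ψ`
  have hprod := card_pullback_prod hψ (map_mul ψ) hAs hBs C
  have hmain := hKL (n - t) (by omega) _ _ _ hAe' hBe' hCe' hAg' hBg' hCg' hAd' hBd' hCd'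
  rw [hAcard, hBcard, hCcard, hprod] at hmain
  rw [hHcard]
  exact hmain

end Summit.MatrixMultiplication.MatrixMultiplication.Theorems.PolynomialSlack
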